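import Summits.Ventures.PercRepro.C041CycleStatus3
import Summits.Ventures.PercRepro.C041CycleDict

/-!
# ROW C-041 — THE COLOURINGS OF THE CYCLE WITH THREE EXITS, COUNTED BY THE TYPES OF ITS FOUR ARCS (p6, gen 31;
groundwork for the dictionary with mine-3's three-exit arc-type model `thetaSq`)

With the exits `0 < i < j < k` the cycle `cyc n` splits into the arcs `[0, i)`, `[i, j)`, `[j, k)`, `[k, n]`; a
colouring is the quadruple of its restrictions (`arcsEquiv4`), and the colourings with prescribed arc types
number `multN t₁ i · multN t₂ (j − i) · multN t₃ (k − j) · multN t₄ (n + 1 − k)` (`card_code_eq4`; `1`, `1` or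
`2^ℓ − 2` per arc, `C041CycleDict`).  The identification of `contrib3` with mine-3's 81-case table `sqCol` and the
assembly `Π(cyc3) = thetaSq` are `C041CycleDict3`.
-/

namespace PercRepro

namespace ZoneZ

namespace TwoExit

open ZoneData Pendant TreeClosure RelaxedTriangle Finset

variable (n : ℕ) (i j k : Fin (n + 1))

/-- The edges of the third arc `[j, k)`. -/
abbrev S₃' := {x : Fin (n + 1) // arc₃' n j k x}
/-- The edges of the last arc `[k, n]`. -/
abbrev S₄ := {x : Fin (n + 1) // arc₄ n k x}

/-- Decidability of the arcs. -/
instance : DecidablePred (arc₃' n j k) := fun x => inferInstanceAs (Decidable (j.val ≤ x.val ∧ x.val < k.val))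
/-- Decidability of the arcs. -/
instance : DecidablePred (arc₄ n k) := fun x => inferInstanceAs (Decidable (k.val ≤ x.val))

/-- A colouring of the cycle is the quadruple of its restrictions to the four arcs (`i ≤ j ≤ k`). -/
def arcsEquiv4 (hij : i.val ≤ j.val) (hjk : j.val ≤ k.val) :
    (Fin (n + 1) → Bool) ≃ (S₁ n i → Bool) × (S₂ n i j → Bool) × (S₃' n j k → Bool) × (S₄ n k → Bool) where
  toFun ω := (fun s => ω s.val, fun s => ω s.val, fun s => ω s.val, fun s => ω s.val)
  invFun f x :=
    if h1 : arc₁ n i x then f.1 ⟨x, h1⟩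
    else if h2 : arc₂ n i j x then f.2.1 ⟨x, h2⟩
    else if h3 : arc₃' n j k x then f.2.2.1 ⟨x, h3⟩
    else f.2.2.2 ⟨x, by unfold arc₁ at h1; unfold arc₂ at h2; unfold arc₃' at h3; unfold arc₄; omega⟩
  left_inv ω := by
    funext x
    by_cases h1 : arc₁ n i x
    · simp only [h1, dite_true]
    · by_cases h2 : arc₂ n i j x
      · simp only [h1, h2, dite_true, dite_false]
      · by_cases h3 : arc₃' n j k x
        · simp only [h1, h2, h3, dite_true, dite_false]
        · simp only [h1, h2, h3, dite_false]
  right_inv f := by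
    obtain ⟨f₁, f₂, f₃, f₄⟩ := f
    refine Prod.ext ?_ (Prod.ext ?_ (Prod.ext ?_ ?_))
    · funext s
      obtain ⟨x, hx⟩ := s
      simp only [hx, dite_true]
    · funext s
      obtain ⟨x, hx⟩ := s
      have h1 : ¬ arc₁ n i x := by unfold arc₁; unfold arc₂ at hx; omega
      simp only [h1, hx, dite_true, dite_false]
    · funext s
      obtain ⟨x, hx⟩ := s
      have h1 : ¬ arc₁ n i x := by unfold arc₁; unfold arc₃' at hx; omega
      have h2 : ¬ arc₂ n i j x := by unfold arc₂; unfold arc₃' at hx; omega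
      simp only [h1, h2, hx, dite_true, dite_false]
    · funext s
      obtain ⟨x, hx⟩ := s
      have h1 : ¬ arc₁ n i x := by unfold arc₁; unfold arc₄ at hx; omega
      have h2 : ¬ arc₂ n i j x := by unfold arc₂; unfold arc₄ at hx; omega
      have h3 : ¬ arc₃' n j k x := by unfold arc₃'; unfold arc₄ at hx; omega
      simp only [h1, h2, h3, dite_false]

/-- The lengths of the arcs. -/
theorem card_S₃' : Fintype.card (S₃' n j k) = k.val - j.val := by
  rw [Fintype.card_subtype]
  have : (univ.filter fun x : Fin (n + 1) => arc₃' n j k x) = Finset.Ico j k := by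
    ext x
    simp only [Finset.mem_filter, Finset.mem_univ, true_and, Finset.mem_Ico, arc₃', Fin.lt_def, Fin.le_def]
  rw [this, Fin.card_Ico]

/-- The lengths of the arcs. -/
theorem card_S₄ : Fintype.card (S₄ n k) = n + 1 - k.val := by
  rw [Fintype.card_subtype]
  have : (univ.filter fun x : Fin (n + 1) => arc₄ n k x) = Finset.Ici k := by
    ext x
    simp only [Finset.mem_filter, Finset.mem_univ, true_and, Finset.mem_Ici, arc₄, Fin.le_def]
  rw [this, Fin.card_Ici]

open Classical in
/-- **The colourings of the cycle with prescribed types on its four arcs**: `1`, `1` or `2^ℓ − 2` per arc,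
multiplied. -/
theorem card_code_eq4 (hi : 0 < i.val) (hij : i.val < j.val) (hjk : j.val < k.val) (t₁ t₂ t₃ t₄ : Fin 3) :
    #(univ.filter fun ω : Fin (n + 1) → Bool =>
        (code n (arc₁ n i) ω, code n (arc₂ n i j) ω, code n (arc₃' n j k) ω, code n (arc₄ n k) ω) =
          (t₁, t₂, t₃, t₄)) =
      multN t₁ i.val * (multN t₂ (j.val - i.val) * (multN t₃ (k.val - j.val) * multN t₄ (n + 1 - k.val))) := by
  have h₁ : Nonempty (S₁ n i) := ⟨⟨0, by unfold arc₁; simp only [Fin.val_zero]; exact hi⟩⟩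
  have h₂ : Nonempty (S₂ n i j) := ⟨⟨i, by unfold arc₂; exact ⟨le_rfl, hij⟩⟩⟩
  have h₃ : Nonempty (S₃' n j k) := ⟨⟨j, by unfold arc₃'; exact ⟨le_rfl, hjk⟩⟩⟩
  have h₄ : Nonempty (S₄ n k) := ⟨⟨k, by unfold arc₄; exact le_rfl⟩⟩
  have e : #(univ.filter fun ω : Fin (n + 1) → Bool =>
      (code n (arc₁ n i) ω, code n (arc₂ n i j) ω, code n (arc₃' n j k) ω, code n (arc₄ n k) ω) =
        (t₁, t₂, t₃, t₄)) =
      #(univ.filter fun f : (S₁ n i → Bool) × (S₂ n i j → Bool) × (S₃' n j k → Bool) × (S₄ n k → Bool) =>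
        codeF f.1 = t₁ ∧ (codeF f.2.1 = t₂ ∧ (codeF f.2.2.1 = t₃ ∧ codeF f.2.2.2 = t₄))) := by
    refine Finset.card_equiv (arcsEquiv4 n i j k hij.le hjk.le) fun ω => ?_
    rw [Finset.mem_filter, Finset.mem_filter]
    simp only [Finset.mem_univ, true_and, Prod.mk.injEq, arcsEquiv4, Equiv.coe_fn_mk, code_eq_codeF]
  rw [e, card_filter_prod' (fun f₁ : S₁ n i → Bool => codeF f₁ = t₁)
    (fun p : (S₂ n i j → Bool) × (S₃' n j k → Bool) × (S₄ n k → Bool) =>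
      codeF p.1 = t₂ ∧ (codeF p.2.1 = t₃ ∧ codeF p.2.2 = t₄)),
    card_filter_prod' (fun f₂ : S₂ n i j → Bool => codeF f₂ = t₂)
    (fun p : (S₃' n j k → Bool) × (S₄ n k → Bool) => codeF p.1 = t₃ ∧ codeF p.2 = t₄),
    card_filter_prod' (fun f₃ : S₃' n j k → Bool => codeF f₃ = t₃) (fun f₄ : S₄ n k → Bool => codeF f₄ = t₄),
    card_codeF_eq h₁, card_codeF_eq h₂, card_codeF_eq h₃, card_codeF_eq h₄, card_S₁, card_S₂, card_S₃', card_S₄]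

end TwoExit

end ZoneZ

end PercRepro
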